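import Summits.CriticalPhenomena.PercolationContinuityZ3.Theorems.PercNearOneGluingNoHeavyLowerTailTwoLevelLonelyRelayTools
import Summits.CriticalPhenomena.PercolationContinuityZ3.Theorems.PercNearOneGluingNearOneGluingLaminar
import HarnessLib

/-!
# `NoHeavyLowerTail` (stmt-CriticalPhenomena-4575) — tools for the LAMINAR LONELY RELAY theorem

Support file (factory prove seat `prim-ineq-prove-3`, gen 3; `--supports stmt-CriticalPhenomena-4575`); no
definitions, no named facts.  `μ = prodBernoulli w` on `Fin n`, relays `A`, observer `o`; for `W ⊆ A`,
`D_W = {W ↮ A∖W}`, `E_W = {o ↔ W}`, `φ(W) = μ(D_W ∩ E_W)/μ(D_W)` (Kozma–Nitzan's `φ`).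
* `lemma2_blocks_ratio` — Kozma–Nitzan Lemma 2 (arXiv:2401.12397 p. 6, `Σ_k φ(X_k) ≤ φ(X)`) for pairwise
  disjoint BLOCKS `T ∈ CH` inside `W`, ratio form under positivity (the singleton case is
  `TwoLevelLonelyRelay.lemma2_ratio`);
* `ancestors_pred_eq` — the side event `J(𝒜) = {every Q ∈ 𝒜 is joined to A∖Q}` read off the clusters of `A∖R`
  when every `Q ∈ 𝒜` contains `R` (so that it is an admissible increasing event in the two-set BHK inequality
  given `{R ↮ A∖R}`);
* `iso_reach_side_le` — `μ(D_R ∩ (E_R ∩ J(𝒜))) · μ(D_R) ≤ μ(D_R ∩ E_R) · μ(D_R ∩ J(𝒜))` (two-set BHK, negative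
  correlation): the observer's attachment to an isolated block is not helped by the outside being well connected.
-/

namespace Summit.CriticalPhenomena.PercolationContinuityZ3.Theorems

open scoped BigOperators Classical
open MeasureTheory Set
open Literature.Probability.LatticeModels (prodBernoulli)
open Literature.Probability.Percolation

variable {n : ℕ}

namespace TwoLevelLonelyRelay

/-- The events `M ∩ {o ↔ T}`, `T ∈ CH`, are pairwise disjoint when `M` separates every block `T ∈ CH` from
`A ∖ T` and the blocks are disjoint subsets of `A`. [folklore] -/
theorem pairwiseDisjoint_reach_inter (A : Finset (Fin n)) (CH : Finset (Finset (Fin n)))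
    (hCHA : ∀ T ∈ CH, T ⊆ A) (hdisj : ∀ T ∈ CH, ∀ T' ∈ CH, T ≠ T' → Disjoint T T') (o : Fin n)
    (M : Set (BondConfig (Fin n)))
    (hM : M ⊆ {ω | ∀ T ∈ CH, ∀ x ∈ T, ∀ y ∈ A \ T, ω ∉ openConn x y}) :
    (↑CH : Set (Finset (Fin n))).PairwiseDisjoint fun T => M ∩ {ω | ∃ x ∈ T, ω ∈ openConn o x} := by
  intro T hT T' hT' hne
  simp only [Function.onFun]
  refine Set.disjoint_left.2 fun ω hω hω' => ?_
  obtain ⟨hωM, x, hx, hox⟩ := hω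
  obtain ⟨-, x', hx', hox'⟩ := hω'
  have hxx' : (openGraph ω).Reachable x x' := (SimpleGraph.Reachable.symm hox).trans hox'
  have hx'T : x' ∉ T := fun h =>
    (Finset.disjoint_left.1 (hdisj T (Finset.mem_coe.1 hT) T' (Finset.mem_coe.1 hT') hne)) h hx'
  exact hM hωM T (Finset.mem_coe.1 hT) x hx x' (Finset.mem_sdiff.2 ⟨hCHA T' (Finset.mem_coe.1 hT') hx', hx'T⟩) hxx'

/-- **Kozma–Nitzan Lemma 2 for disjoint blocks, ratio form.**  `μ = prodBernoulli w`, relays `A`, a block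
`W ⊆ A`, pairwise disjoint sub-blocks `T ∈ CH` of `W`, observer `o`; `D_X = {X ↮ A∖X}`, `E_X = {o ↔ X}`.  If
`M = D_W ∩ ⋂_{T ∈ CH} D_T` is non-null then  `(Σ_{T ∈ CH} μ(D_T ∩ E_T)/μ(D_T)) · μ(D_W) ≤ μ(D_W ∩ E_W)`,
i.e. `Σ_T φ(T) ≤ φ(W)`.  Proof as printed: Lemma 1(i) per block (`twoSet_pos`), disjointness of `E_T ∩ M`,
Lemma 1(ii) for `W` (`sameSide_neg`). [cite: KozmaNitzan2024, Lemma 2 (p. 6)] -/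
theorem lemma2_blocks_ratio (w : Sym2 (Fin n) → unitInterval) (A W : Finset (Fin n))
    (CH : Finset (Finset (Fin n))) (hWA : W ⊆ A) (hCH : ∀ T ∈ CH, T ⊆ W)
    (hdisj : ∀ T ∈ CH, ∀ T' ∈ CH, T ≠ T' → Disjoint T T') (o : Fin n)
    (hM : 0 < (prodBernoulli w).real ({ω | ∀ x ∈ W, ∀ y ∈ A \ W, ω ∉ openConn x y} ∩
      {ω | ∀ T ∈ CH, ∀ x ∈ T, ∀ y ∈ A \ T, ω ∉ openConn x y})) :
    (∑ T ∈ CH, (prodBernoulli w).real ({ω | ∀ x ∈ T, ∀ y ∈ A \ T, ω ∉ openConn x y} ∩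
          {ω | ∃ x ∈ T, ω ∈ openConn o x}) /
        (prodBernoulli w).real {ω | ∀ x ∈ T, ∀ y ∈ A \ T, ω ∉ openConn x y}) *
      (prodBernoulli w).real {ω | ∀ x ∈ W, ∀ y ∈ A \ W, ω ∉ openConn x y} ≤
    (prodBernoulli w).real ({ω | ∀ x ∈ W, ∀ y ∈ A \ W, ω ∉ openConn x y} ∩
      {ω | ∃ x ∈ W, ω ∈ openConn o x}) := by
  set μ := prodBernoulli w with hμ
  set DW : Set (BondConfig (Fin n)) := {ω | ∀ x ∈ W, ∀ y ∈ A \ W, ω ∉ openConn x y} with hDW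
  set M : Set (BondConfig (Fin n)) := DW ∩ {ω | ∀ T ∈ CH, ∀ x ∈ T, ∀ y ∈ A \ T, ω ∉ openConn x y}
    with hMdef
  set EW : Set (BondConfig (Fin n)) := {ω | ∃ x ∈ W, ω ∈ openConn o x} with hEW
  have hCHA : ∀ T ∈ CH, T ⊆ A := fun T hT => (hCH T hT).trans hWA
  have hM_sub_DT : ∀ T ∈ CH, M ⊆ {ω | ∀ x ∈ T, ∀ y ∈ A \ T, ω ∉ openConn x y} :=
    fun T hT ω hω => hω.2 T hT
  have hDT_pos : ∀ T ∈ CH, 0 < μ.real {ω | ∀ x ∈ T, ∀ y ∈ A \ T, ω ∉ openConn x y} :=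
    fun T hT => lt_of_lt_of_le hM (measureReal_mono (hM_sub_DT T hT))
  have hDW_pos : 0 < μ.real DW := lt_of_lt_of_le hM (measureReal_mono fun ω hω => hω.1)
  -- Step 1: Lemma 1(i) per block
  have step1 : ∀ T ∈ CH,
      μ.real ({ω | ∀ x ∈ T, ∀ y ∈ A \ T, ω ∉ openConn x y} ∩ {ω | ∃ x ∈ T, ω ∈ openConn o x}) *
          μ.real M ≤
        μ.real {ω | ∀ x ∈ T, ∀ y ∈ A \ T, ω ∉ openConn x y} *
          μ.real (M ∩ {ω | ∃ x ∈ T, ω ∈ openConn o x}) := by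
    intro T hT
    have hTA := hCHA T hT
    have key := twoSet_pos w (↑T : Set (Fin n)) (↑(A \ T) : Set (Fin n))
      (fun C => ∃ x ∈ T, (SimpleGraph.fromEdgeSet C).Reachable x o) (fun _ => True)
      (fun E => (∀ x ∈ W, x ∉ T → ∀ y ∈ A \ W, ¬ (SimpleGraph.fromEdgeSet E).Reachable x y) ∧
        (∀ T' ∈ CH, T' ≠ T → ∀ x ∈ T', ∀ y ∈ A \ T', ¬ (SimpleGraph.fromEdgeSet E).Reachable x y))
      (fun C C' hCC' ⟨x, hx, h⟩ => ⟨x, hx, reachable_fromEdgeSet_mono hCC' h⟩) (fun _ _ _ h => h)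
      (fun E E' hEE' h => ⟨fun x hx hxT y hy hr => h.1 x hx hxT y hy (reachable_fromEdgeSet_mono hEE' hr),
        fun T' hT' hne x hx y hy hr => h.2 T' hT' hne x hx y hy (reachable_fromEdgeSet_mono hEE' hr)⟩)
    have hR : {ω : BondConfig (Fin n) | ∀ x ∈ T, ∀ y ∈ A \ T, ω ∉ openConn x y} ∩
        {ω | True ∧ ((∀ x ∈ W, x ∉ T → ∀ y ∈ A \ W, ¬ (SimpleGraph.fromEdgeSet
            (⋃ t ∈ (↑(A \ T) : Set (Fin n)), openEdgeCluster ω t)).Reachable x y) ∧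
          (∀ T' ∈ CH, T' ≠ T → ∀ x ∈ T', ∀ y ∈ A \ T', ¬ (SimpleGraph.fromEdgeSet
            (⋃ t ∈ (↑(A \ T) : Set (Fin n)), openEdgeCluster ω t)).Reachable x y))} = M := by
      ext ω
      simp only [Set.mem_inter_iff, Set.mem_setOf_eq, true_and, hMdef, hDW]
      constructor
      · rintro ⟨h0, h1, h2⟩
        refine ⟨fun x hx y hy => ?_, fun T' hT' x hx y hy => ?_⟩
        · by_cases hxT : x ∈ T
          · exact h0 x hxT y (Finset.mem_sdiff.2 ⟨(Finset.mem_sdiff.1 hy).1,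
              fun h => (Finset.mem_sdiff.1 hy).2 (hCH T hT h)⟩)
          · intro hr
            exact h1 x hx hxT y hy ((reachable_clusterUnion_iff ω _
              (Finset.mem_coe.2 (Finset.mem_sdiff.2 ⟨hWA hx, hxT⟩)) y).2 hr)
        · by_cases hTT : T' = T
          · subst hTT; exact h0 x hx y hy
          · intro hr
            have hxT : x ∉ T := fun h => (Finset.disjoint_left.1 (hdisj T' hT' T hT hTT)) hx h
            exact h2 T' hT' hTT x hx y hy ((reachable_clusterUnion_iff ω _
              (Finset.mem_coe.2 (Finset.mem_sdiff.2 ⟨hCHA T' hT' hx, hxT⟩)) y).2 hr)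
      · rintro ⟨h1, h2⟩
        refine ⟨h2 T hT, fun x hx hxT y hy hr => ?_, fun T' hT' hTT x hx y hy hr => ?_⟩
        · exact h1 x hx y hy ((reachable_clusterUnion_iff ω _
            (Finset.mem_coe.2 (Finset.mem_sdiff.2 ⟨hWA hx, hxT⟩)) y).1 hr)
        · have hxT : x ∉ T := fun h => (Finset.disjoint_left.1 (hdisj T' hT' T hT hTT)) hx h
          exact h2 T' hT' x hx y hy ((reachable_clusterUnion_iff ω _
            (Finset.mem_coe.2 (Finset.mem_sdiff.2 ⟨hCHA T' hT' hx, hxT⟩)) y).1 hr)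
    rw [sep_coe_eq, reach_pred_eq] at key
    rw [← Set.inter_assoc, hR] at key
    have hlast : {ω : BondConfig (Fin n) | ∀ x ∈ T, ∀ y ∈ A \ T, ω ∉ openConn x y} ∩
          {ω | ∃ x ∈ T, ω ∈ openConn o x} ∩
        {ω | True ∧ ((∀ x ∈ W, x ∉ T → ∀ y ∈ A \ W, ¬ (SimpleGraph.fromEdgeSet
            (⋃ t ∈ (↑(A \ T) : Set (Fin n)), openEdgeCluster ω t)).Reachable x y) ∧
          (∀ T' ∈ CH, T' ≠ T → ∀ x ∈ T', ∀ y ∈ A \ T', ¬ (SimpleGraph.fromEdgeSet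
            (⋃ t ∈ (↑(A \ T) : Set (Fin n)), openEdgeCluster ω t)).Reachable x y))} =
        M ∩ {ω | ∃ x ∈ T, ω ∈ openConn o x} := by
      rw [Set.inter_assoc, Set.inter_comm {ω | ∃ x ∈ T, ω ∈ openConn o x}, ← Set.inter_assoc, hR]
    rw [hlast] at key
    exact key
  -- Step 2: disjointness under `M`
  have step2 : ∑ T ∈ CH, μ.real (M ∩ {ω | ∃ x ∈ T, ω ∈ openConn o x}) ≤ μ.real (M ∩ EW) := by
    rw [← measureReal_biUnion_finset (pairwiseDisjoint_reach_inter A CH hCHA hdisj o M (fun ω hω => hω.2))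
      (fun T _ => MeasurableSet.of_discrete)]
    refine measureReal_mono (Set.iUnion₂_subset fun T hT ω hω => ?_)
    obtain ⟨hωM, x, hx, hox⟩ := hω
    exact ⟨hωM, x, hCH T (Finset.mem_coe.1 hT) hx, hox⟩
  -- Step 3: Lemma 1(ii) for `W`
  have step3 : μ.real DW * μ.real (M ∩ EW) ≤ μ.real (DW ∩ EW) * μ.real M := by
    have key := sameSide_neg w (↑W : Set (Fin n)) (↑(A \ W) : Set (Fin n))
      (fun C => ∃ x ∈ W, (SimpleGraph.fromEdgeSet C).Reachable x o)
      (fun C => ∀ T ∈ CH, ∀ x ∈ T, ∀ y ∈ W \ T, ¬ (SimpleGraph.fromEdgeSet C).Reachable x y)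
      (fun C C' hCC' ⟨x, hx, h⟩ => ⟨x, hx, reachable_fromEdgeSet_mono hCC' h⟩)
      (fun C C' hCC' h T hT x hx y hy hr => h T hT x hx y hy (reachable_fromEdgeSet_mono hCC' hr))
    have hI : {ω : BondConfig (Fin n) | ∀ x ∈ W, ∀ y ∈ A \ W, ω ∉ openConn x y} ∩
        {ω | ∀ T ∈ CH, ∀ x ∈ T, ∀ y ∈ W \ T, ¬ (SimpleGraph.fromEdgeSet
          (⋃ s ∈ (↑W : Set (Fin n)), openEdgeCluster ω s)).Reachable x y} = M := by
      ext ω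
      simp only [Set.mem_inter_iff, Set.mem_setOf_eq, hMdef, hDW]
      constructor
      · rintro ⟨h1, h2⟩
        refine ⟨h1, fun T hT x hx y hy => ?_⟩
        obtain ⟨hyA, hyT⟩ := Finset.mem_sdiff.1 hy
        by_cases hyW : y ∈ W
        · intro hr
          exact h2 T hT x hx y (Finset.mem_sdiff.2 ⟨hyW, hyT⟩)
            ((reachable_clusterUnion_iff ω _ (Finset.mem_coe.2 (hCH T hT hx)) y).2 hr)
        · exact h1 x (hCH T hT hx) y (Finset.mem_sdiff.2 ⟨hyA, hyW⟩)
      · rintro ⟨h1, h2⟩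
        refine ⟨h1, fun T hT x hx y hy hr => ?_⟩
        exact h2 T hT x hx y (Finset.mem_sdiff.2 ⟨hWA (Finset.mem_sdiff.1 hy).1, (Finset.mem_sdiff.1 hy).2⟩)
          ((reachable_clusterUnion_iff ω _ (Finset.mem_coe.2 (hCH T hT hx)) y).1 hr)
    rw [sep_coe_eq, reach_pred_eq] at key
    have hI' : {ω : BondConfig (Fin n) | ∀ x ∈ W, ∀ y ∈ A \ W, ω ∉ openConn x y} ∩
        ({ω | ∃ x ∈ W, ω ∈ openConn o x} ∩ {ω | ∀ T ∈ CH, ∀ x ∈ T, ∀ y ∈ W \ T,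
          ¬ (SimpleGraph.fromEdgeSet (⋃ s ∈ (↑W : Set (Fin n)), openEdgeCluster ω s)).Reachable x y}) =
        M ∩ EW := by
      rw [Set.inter_left_comm, hI, Set.inter_comm]
    rw [hI', hI] at key
    exact key
  -- assembly
  have hm : 0 < μ.real M := hM
  have hsum1 : ∀ T ∈ CH,
      μ.real ({ω | ∀ x ∈ T, ∀ y ∈ A \ T, ω ∉ openConn x y} ∩ {ω | ∃ x ∈ T, ω ∈ openConn o x}) /
          μ.real {ω | ∀ x ∈ T, ∀ y ∈ A \ T, ω ∉ openConn x y} ≤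
        μ.real (M ∩ {ω | ∃ x ∈ T, ω ∈ openConn o x}) / μ.real M := by
    intro T hT
    rw [div_le_div_iff₀ (hDT_pos T hT) hm]
    linarith [step1 T hT, mul_comm (μ.real (M ∩ {ω | ∃ x ∈ T, ω ∈ openConn o x}))
      (μ.real {ω | ∀ x ∈ T, ∀ y ∈ A \ T, ω ∉ openConn x y})]
  calc (∑ T ∈ CH, μ.real ({ω | ∀ x ∈ T, ∀ y ∈ A \ T, ω ∉ openConn x y} ∩
            {ω | ∃ x ∈ T, ω ∈ openConn o x}) /
          μ.real {ω | ∀ x ∈ T, ∀ y ∈ A \ T, ω ∉ openConn x y}) * μ.real DW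
      ≤ (∑ T ∈ CH, μ.real (M ∩ {ω | ∃ x ∈ T, ω ∈ openConn o x}) / μ.real M) * μ.real DW :=
        mul_le_mul_of_nonneg_right (Finset.sum_le_sum hsum1) measureReal_nonneg
    _ = (∑ T ∈ CH, μ.real (M ∩ {ω | ∃ x ∈ T, ω ∈ openConn o x})) / μ.real M * μ.real DW := by
        rw [Finset.sum_div]
    _ ≤ μ.real (M ∩ EW) / μ.real M * μ.real DW := by gcongr
    _ ≤ μ.real (DW ∩ EW) := by
        rw [div_mul_eq_mul_div, div_le_iff₀ hm]
        calc μ.real (M ∩ EW) * μ.real DW = μ.real DW * μ.real (M ∩ EW) := mul_comm _ _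
          _ ≤ μ.real (DW ∩ EW) * μ.real M := step3

/-- The side event `J(𝒜)` ("every `Q ∈ 𝒜` is joined to `A ∖ Q`") read off the clusters of `A ∖ R`, when every
`Q ∈ 𝒜` contains `R`. [folklore] -/
theorem ancestors_pred_eq (A R : Finset (Fin n)) (𝒜 : Finset (Finset (Fin n))) (h𝒜 : ∀ Q ∈ 𝒜, R ⊆ Q) :
    {ω : BondConfig (Fin n) | ∀ Q ∈ 𝒜, ∃ q ∈ Q, ∃ y ∈ A \ Q, (SimpleGraph.fromEdgeSet
        (⋃ t ∈ (↑(A \ R) : Set (Fin n)), openEdgeCluster ω t)).Reachable y q} =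
      {ω | ∀ Q ∈ 𝒜, ∃ q ∈ Q, ∃ y ∈ A \ Q, ω ∈ openConn y q} := by
  ext ω
  simp only [Set.mem_setOf_eq]
  constructor
  · intro h Q hQ
    obtain ⟨q, hq, y, hy, hr⟩ := h Q hQ
    have hyR : y ∈ A \ R := Finset.mem_sdiff.2 ⟨(Finset.mem_sdiff.1 hy).1,
      fun hyR => (Finset.mem_sdiff.1 hy).2 (h𝒜 Q hQ hyR)⟩
    exact ⟨q, hq, y, hy, (reachable_clusterUnion_iff ω _ (Finset.mem_coe.2 hyR) q).1 hr⟩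
  · intro h Q hQ
    obtain ⟨q, hq, y, hy, hr⟩ := h Q hQ
    have hyR : y ∈ A \ R := Finset.mem_sdiff.2 ⟨(Finset.mem_sdiff.1 hy).1,
      fun hyR => (Finset.mem_sdiff.1 hy).2 (h𝒜 Q hQ hyR)⟩
    exact ⟨q, hq, y, hy, (reachable_clusterUnion_iff ω _ (Finset.mem_coe.2 hyR) q).2 hr⟩

/-- **Attachment to an isolated block is not helped by outside connections.**  `D_R = {R ↮ A∖R}`,
`E_R = {o ↔ R}`, `J = J(𝒜)` with every `Q ∈ 𝒜` containing `R`: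
`μ(D_R) · μ(D_R ∩ (E_R ∩ J)) ≤ μ(D_R ∩ E_R) · μ(D_R ∩ J)` (two-set BHK, negative correlation; `E_R` increasing on
`C_R`, `J` increasing on `C_{A∖R}`). [cite: VandenbergHaggstromKahn2005, Thm. 1.4 with sets — corollary] -/
theorem iso_reach_side_le (w : Sym2 (Fin n) → unitInterval) (A R : Finset (Fin n)) (o : Fin n)
    (𝒜 : Finset (Finset (Fin n))) (h𝒜 : ∀ Q ∈ 𝒜, R ⊆ Q) :
    (prodBernoulli w).real {ω | ∀ x ∈ R, ∀ y ∈ A \ R, ω ∉ openConn x y} *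
      (prodBernoulli w).real ({ω | ∀ x ∈ R, ∀ y ∈ A \ R, ω ∉ openConn x y} ∩
        ({ω | ∃ x ∈ R, ω ∈ openConn o x} ∩ {ω | ∀ Q ∈ 𝒜, ∃ q ∈ Q, ∃ y ∈ A \ Q, ω ∈ openConn y q})) ≤
    (prodBernoulli w).real ({ω | ∀ x ∈ R, ∀ y ∈ A \ R, ω ∉ openConn x y} ∩
        {ω | ∃ x ∈ R, ω ∈ openConn o x}) *
      (prodBernoulli w).real ({ω | ∀ x ∈ R, ∀ y ∈ A \ R, ω ∉ openConn x y} ∩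
        {ω | ∀ Q ∈ 𝒜, ∃ q ∈ Q, ∃ y ∈ A \ Q, ω ∈ openConn y q}) := by
  have key := twoSet_neg w (↑R : Set (Fin n)) (↑(A \ R) : Set (Fin n))
    (fun C => ∃ x ∈ R, (SimpleGraph.fromEdgeSet C).Reachable x o)
    (fun E => ∀ Q ∈ 𝒜, ∃ q ∈ Q, ∃ y ∈ A \ Q, (SimpleGraph.fromEdgeSet E).Reachable y q)
    (fun C C' hCC' ⟨x, hx, h⟩ => ⟨x, hx, reachable_fromEdgeSet_mono hCC' h⟩)
    (fun E E' hEE' h Q hQ => by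
      obtain ⟨q, hq, y, hy, hr⟩ := h Q hQ
      exact ⟨q, hq, y, hy, reachable_fromEdgeSet_mono hEE' hr⟩)
  rw [sep_coe_eq, reach_pred_eq, ancestors_pred_eq A R 𝒜 h𝒜] at key
  exact key

end TwoLevelLonelyRelay

end Summit.CriticalPhenomena.PercolationContinuityZ3.Theorems
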